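import Summits.AtomisticToContinuum.Crystallization.Theorems.FrustratedLawDichotomyStrainedPatchHomEntryLeafHTA2QCellB08M2
import Summits.AtomisticToContinuum.Crystallization.Theorems.FrustratedLawDichotomyStrainedPatchHomEntryLeafHTA2QSq

/-!
# ★★★ THE `0.8 t_b` FIVE-COARSE CELL END TO END WITH ONE INNER LEAF: `entryLeafOKHT4A2QQDCRS muRec qX90c pB08M2 QB08M GnB08M JB08 .leaf cT080 wB08M = true`
# (27623 `(H) HomFloor (1/625)`, hcp half; hand-1 g36; critic row 1360 (3) «0.8 t_b: ≈ 64 inner leaves ≈ 1900 s/cell ⇒ not production; box-halving lever» — superseded)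

decomp-a2c hand-1 g36 (crux `AperiodicFrustratedLawGap`, stmt-AtomisticToContinuum-27623).  KERNEL: ★ `treeA2QS_B08M` — ONE inner hull leaf of the squared-test inner
verdict `…SqKit.entryLeafOKHQDCRS muRec qX90c` closes the sheet-tracked confined box `htWr pB08M2 = (2.152, 2.760, 1.003)e-3` (+ hull `(1.611, 1.841, 0.097)e-3`) of the
`0.8 t_b` five-coarse cell (seat probe R8: true; the inner verdict of record: false — hand-1 g35 §3f measured its budget there at `(2.2–2.5, 2.5–2.9, 0.4–0.55)e-3` ⇒
≈ 64 leaves); with `…CellB08M2.htCertSideA2Q_B08M2`: ★★★ `entryLeafOKHT4A2QQDCRS_B08M2` and ★ `okSE_B08M` (one-leaf ∃-tree of the production verdict v2).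
PER-CELL COST at `0.8 t_b` (five coarse axes): ≈ 500 s instead of ≈ 1900 s.  Per hand-1 g36 probe Q6 the full `2⁻⁹` cube is NOT available at `0.8 t_b` (entries
`2⁻⁹` fail the squared test at every ξ-box: the U-part of the exact functional + the centre misfit `0.040` exceed `η′`), so this mixed cell is the band's production form.

Kernel fact + assembly; 0 sorry; standard axioms; no definitions.  `--supports stmt-AtomisticToContinuum-27623`.
-/

namespace Summit.AtomisticToContinuum.Crystallization.Theorems.FrustratedLawDichotomyStrainedPatchHomEntryLeafHT

open Literature.Analysis.ValidatedNumerics.Numerics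
open Summit.AtomisticToContinuum.Crystallization.Theorems.FrustratedLawDichotomyStrainedPatchHomCertTree (CertTree treeOK)
open Summit.AtomisticToContinuum.Crystallization.Theorems.FrustratedLawDichotomyStrainedPatchHomEntryTable (muRec)
open Summit.AtomisticToContinuum.Crystallization.Theorems.FrustratedLawDichotomyStrainedPatchHomEntryFitTolerance (cT080)
open Summit.AtomisticToContinuum.Crystallization.Theorems.FrustratedLawDichotomyStrainedPatchHomEntryFitHcpCentred (entryLeafOKHQDCRS)
open Summit.AtomisticToContinuum.Crystallization.Theorems.FrustratedLawDichotomyStrainedPatchHomSlopeLJ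
open Summit.AtomisticToContinuum.Crystallization.Theorems.FrustratedLawDichotomyStrainedPatchHomSlopeLJAffine
open Summit.AtomisticToContinuum.Crystallization.Theorems.FrustratedLawDichotomyStrainedPatchHomSlopeLJAffine2Kit

set_option maxRecDepth 100000 in
set_option maxHeartbeats 4000000 in
/-- ★ KERNEL: ONE inner hull leaf of the squared-test inner verdict closes the second-order confined box of the `0.8 t_b` five-coarse cell. -/
theorem treeA2QS_B08M : treeOK (hullInner (entryLeafOKHQDCRS muRec qX90c) JB08 cT080) CertTree.leaf cT080 (htWr pB08M2 cT080 wB08M) = true := by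
  decide +kernel

/-- ★★★ **THE `0.8 t_b` FIVE-COARSE CELL CLOSES END TO END THROUGH THE SECOND-ORDER AFFINE LEAF WITH THE SQUARED INNER TEST** (one inner leaf). [assembly] -/
theorem entryLeafOKHT4A2QQDCRS_B08M2 : entryLeafOKHT4A2QQDCRS muRec qX90c pB08M2 QB08M GnB08M JB08 CertTree.leaf cT080 wB08M = true := by
  have h1 := htCertSideA2Q_B08M2
  have h2 := treeA2QS_B08M
  unfold entryLeafOKHT4A2QQDCRS entryLeafOKHT4A2Q
  rw [h1, h2]
  rfl

/-- ★ … hence the `0.8 t_b` five-coarse cell is a one-leaf ∃-tree of the production verdict v2 `entryLeafOKHT4A2QQDCRSE muRec`. [formal bookkeeping] -/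
theorem okSE_B08M : ∃ t : CertTree ((Fin 3 × Fin 3) ⊕ Fin 3), treeOK (entryLeafOKHT4A2QQDCRSE muRec) t cT080 wB08M = true :=
  exists_tree_HT4A2QQDCRSE_of_certS entryLeafOKHT4A2QQDCRS_B08M2
end Summit.AtomisticToContinuum.Crystallization.Theorems.FrustratedLawDichotomyStrainedPatchHomEntryLeafHT
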